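import Summits.BirchSwinnertonDyer.BirchSwinnertonDyer.Theses.PAdicOrder
import Summits.BirchSwinnertonDyer.BirchSwinnertonDyer.Theses.PAdicOrderV2
import Summits.BirchSwinnertonDyer.BirchSwinnertonDyer.Theses.SelmerRank
import Summits.BirchSwinnertonDyer.BirchSwinnertonDyer.Theorems.PAdicOrderV2PadicBSDrankOfItems
import Summits.BirchSwinnertonDyer.BirchSwinnertonDyer.Theorems.PAdicOrderV2PadicBSDrankOfItemsAtTwo
import Summits.BirchSwinnertonDyer.BirchSwinnertonDyer.Theorems.PAdicOrderV2PadicBSDrankOfItemsParity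
import Literature.Barriers.BirchSwinnertonDyer.PAdicFunctionalEquationParityTransferProofs
import Literature.NumberTheory.EllipticCurves.PAdicLFunctionRiemannSumCertificateProofs
import Literature.NumberTheory.EllipticCurves.PAdicBSD
import Literature.NumberTheory.EllipticCurves.KatoRankBound
import Literature.NumberTheory.EllipticCurves.OrdinaryPrimesProofs

/-!
# Crux `PAdicOrderPadicBSDrankR2` (stmt-BirchSwinnertonDyer-0490) — line `Sketch`
# (idea `pconverse-corank-split`): lead skeleton, v7.1 (lead c4, 2026-08-17)

Crux (routes `PAdicOrderV2` / `PAdicOrder`, item #3): for every elliptic `E/ℚ` (globally minimal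
`W`), every prime `p` of good ordinary reduction and the newform `f` of `E`,
`ord_{T=0} L_p(E,T) = rank E(ℚ)` — Mazur–Tate–Teitelbaum's BSD(`p`), rank clause, at EVERY good
ordinary prime (open in print; Delbourgo 2008 Conj. 2.3(i)).

## Shape (v7) — TWO compositions; (A) stub-free from four route items, (B) items + K3 + NE2w

(A) ROUTE ITEMS ONLY, no stub (unchanged from v6, landed p138121):
`pAdicOrderPadicBSDrankR2_of_comparison` — `PAdicOrderMainConjectureR7` (stmt-15426) →
`PAdicOrderSemisimpleR3` (stmt-0509) → `SelmerRankShaPFinite` (stmt-0132) → `PAdicOrderComparisonR2`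
(stmt-0489, crux #2) → crux (`ord_T L_p = r_an = ord_T L_q = rank`, `q ≥ 5` good ordinary).

(B) WITHOUT crux #2 — v7 RESHAPE (what changed since v6). New tree input (lead c4, Literature):
the `p`-adic functional equation is parity-free and level-free in the tree
(`padicLFunction_mem_padicFEClass_neg_frickeEigenvalue`: sign `-ε(f)` at EVERY good ordinary prime),
whence the PARITY TRANSFER `even_order_padicLFunction_iff_even_order`
(`Literature/Barriers/BirchSwinnertonDyer/PAdicFunctionalEquationParityTransferProofs`, p161886):
`ord_T L_p ≡ ord_T L_q (mod 2)` for any two good ordinary primes, `2` included, any level. Under the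
items `ord_T L_q = rank` at an odd `q`, so at `p = 2`: `ord_T L_2 ≡ rank (mod 2)` and (level-zero
transfer, v5) `1 ≤ ord_T L_2` in positive rank. Consequences (glue LANDED as
`Theorems/PAdicOrderV2PadicBSDrankOfItemsParity.lean`, p162419):
* rank `2` at `p = 2` no longer needs Kato: `2 ≤ ord_T L_2` from `1 ≤ ord` + parity
  (`padicBSDrank_two_le_order_of_items`) — v6's stub K (Kato 18.4 at `2` from rank `2` on) shrinks to
  **K3 = Kato 18.4 at `2` for curves of rank `≥ 3`** (`stub_padicBSDrank_kato3`; literature debt,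
  strictly weaker than print; explicit signature — v6's K was typed through the named-fact wrapper
  `kato_selmerCorank_le_order_padicLFunction_allPrimes` and flagged mis-typed by the harness);
* an excess of exactly ONE zero at `2` contradicts parity, so v6's NE2⁺ (`ord_T L_2 ≤ corank`) weakens
  to **NE2w = "no excess PAIR of zeros": `ord_T L_2 ≤ corank Sel_{2^∞} + 1` in positive rank**
  (`stub_padicBSDrank_noExcessPairTwoPos`; OPEN beyond print, strictly weaker than NE2⁺);
* the exact `p = 2` residue given the items is now (`padicBSDrank_atTwo_iff_of_items₃`):
  crux at `(W,2,f)` **iff** (`3 ≤ rank ⇒ corank ≤ ord_T L_2`) ∧ (`1 ≤ rank ⇒ ord_T L_2 ≤ corank + 1`).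
Also new this cycle (lead c4): the Riemann-sum CERTIFICATE theorem
`order_padicLFunction_le_of_riemannSum_certificate` (Literature, p140228) and the parity squeeze
`order_padicLFunction_eq_two_of_rootNumber_eq_one_anyPrime` (p161777), with CERTIFIED `p = 2`
numerics (crux workfile `NUMBERS-c4-p2.md`, kit jobs j022327 done / j026130, j026132 queued): the
tree's own `padicLRiemannSum` at `p = 2` evaluated exactly from modular symbols — every tested
2-ordinary curve (a₂ = ±1, ranks 0–2, including the disprover's unresolved a₂ = +1 rank-2 curve
N = 2813) has `ord_T L_2(E,T) ≤ rank` certified, i.e. NE2⁺/NE2w hold there; 0 anomalies.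

## Registered stubs (v7)

* LANDED this cycle: `stub_padicBSDrank_parity` (PT, = the parity transfer) with the v7 glue, p162419
  (`Theorems/PAdicOrderV2PadicBSDrankOfItemsParity.lean`).
* `stub_padicBSDrank_kato3` (K3) — LITERATURE DEBT: Kato, Astérisque 295, Thm 18.4 at `p = 2`, used only
  for curves of rank `≥ 3`: `corank_{ℤ_2} Sel_{2^∞}(E/ℚ) ≤ ord_{T=0} L_2(E,T)`.
* `stub_padicBSDrank_noExcessPairTwoPos` (NE2w) — OPEN beyond print: at `p = 2` in positive rank,
  `ord_{T=0} L_2(E,T) ≤ corank_{ℤ_2} Sel_{2^∞}(E/ℚ) + 1`.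
* LANDED earlier (leads 0–c3): `levelZero` p97204, `noExcessOne` p97633, `knownCases` p98496,
  `orderEqCorankOdd` p135085, `rankEqCorankOfShaFinite` p135243, `control` (in `…OfItems`),
  `levelZeroTransfer` p137447; glue `…OfItems` p137902, `…OfItemsAtTwo` p138121.

Compositions: (A) `pAdicOrderPadicBSDrankR2_of_comparison (hMC) (hSS) (hSha) (hCmp) : crux` — no
stub; (B) `pAdicOrderPadicBSDrankR2_of (hMC) (hSS) (hSha) : crux` = `pAdicOrderPadicBSDrankR2_of_items₃`
applied to K3 and NE2w (and the `…'` twins for route `PAdicOrder`, `Iff.rfl`).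
-/

-- D-0017: single-problem summit, so `Summit.BirchSwinnertonDyer.BirchSwinnertonDyer.…` repeats a
-- namespace BY DESIGN.
set_option linter.dupNamespace false

namespace Summit.BirchSwinnertonDyer.BirchSwinnertonDyer.Theorems

open scoped MatrixGroups ModularForm
open CongruenceSubgroup Literature.NumberTheory.EllipticCurves
  Literature.NumberTheory.EllipticCurves.ModularForms
open Summit.BirchSwinnertonDyer.BirchSwinnertonDyer.Theses.PAdicOrderV2
open Summit.BirchSwinnertonDyer.BirchSwinnertonDyer.Theses.SelmerRank (SelmerRankShaPFinite)

/-! ## Stubs (registered; `sorry` only here: K3 literature debt, NE2w open — PT landed p162419) -/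

/-- **Stub K3 (LITERATURE DEBT — Kato's Selmer-corank bound at `p = 2` for curves of rank `≥ 3`).**
For `E/ℚ` (globally minimal `W`) good ordinary at `p = 2`, the newform `f` of `E`, and
`rank E(ℚ) ≥ 3`: `corank_{ℤ_2} Sel_{2^∞}(E/ℚ) ≤ ord_{T=0} L_2(E,T)`. Kato, Astérisque 295, Thm. 18.4 as
printed (no parity hypothesis; proof = Thm. 17.4 (2) at the height-one prime `(T) ∌ 2`, p. 273); the
rank restriction is what the composition consumes after the parity transfer (rank `≤ 2` at `2` needs
no Kato). Strictly weaker than the named tree fact `kato_selmerCorank_le_order_padicLFunction_allPrimes`.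
[cite: Kato2004Asterisque, Thm. 18.4 (p. 281) and Thm. 17.4 (2) (p. 273)] -/
theorem stub_padicBSDrank_kato3 :
    ∀ (W : WeierstrassCurve ℚ) [W.IsElliptic] [W.IsGloballyMinimal] (p : ℕ) [Fact p.Prime],
      p = 2 → IsOrdinaryAt W p → ∀ {N : ℕ} [NeZero N] (f : CuspForm (Gamma0 N) 2), IsNewformOf W f →
      3 ≤ W.mordellWeilRank →
      (W.selmerCorank p : ℕ∞) ≤ (padicLFunction f (unitRoot W p : ℚ_[p])).order := by
  sorry

/-- **Stub NE2w (OPEN residue, beyond print: no excess PAIR of zeros at `p = 2` in positive rank).**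
For `E/ℚ` (globally minimal `W`) good ordinary at `p = 2` (`a_2` odd), of POSITIVE Mordell–Weil rank,
and the newform `f` of `E`: `ord_{T=0} L_2(E,T) ≤ corank_{ℤ_2} Sel_{2^∞}(E/ℚ) + 1`. By the parity
transfer an excess of exactly one zero is impossible, so this is all that v6's NE2⁺
(`ord_T L_2 ≤ corank`) still has to supply; at odd `p` the analogue is IMC-equality (stmt-15426) ∧
Conj. 1.12 at `T` (stmt-0509) ∧ control — no main conjecture at `2` in print (route kill criterion
(c): a failure here is class MISSTATED, repair `p ≠ 2 →`). Certified instance-by-instance for every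
2-ordinary curve tested so far (`NUMBERS-c4-p2.md`). OPEN. [cite: MazurTateTeitelbaum1986Invent, §II.10] -/
theorem stub_padicBSDrank_noExcessPairTwoPos :
    ∀ (W : WeierstrassCurve ℚ) [W.IsElliptic] [W.IsGloballyMinimal] (p : ℕ) [Fact p.Prime],
      p = 2 → IsOrdinaryAt W p → ∀ {N : ℕ} [NeZero N] (f : CuspForm (Gamma0 N) 2), IsNewformOf W f →
      1 ≤ W.mordellWeilRank →
      (padicLFunction f (unitRoot W p : ℚ_[p])).order ≤ (W.selmerCorank p + 1 : ℕ) := by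
  sorry

/-! ## Composition (A): the crux from FOUR ROUTE ITEMS (crux #2 among them), no stub -/

/-- **Composition (A) (line `Sketch`, v6/v7): crux #3 from the route items stmt-15426, stmt-0509,
stmt-0132 and crux #2 stmt-0489** — the landed `pAdicOrderPadicBSDrankR2_of_items_of_comparison`
(p138121): `ord_T L_p = r_an = ord_T L_q = rank`, `q ≥ 5` good ordinary.
[cite: MazurTateTeitelbaum1986Invent, §II.10] -/
theorem pAdicOrderPadicBSDrankR2_of_comparison (hMC : PAdicOrderMainConjectureR7)
    (hSS : PAdicOrderSemisimpleR3) (hSha : SelmerRankShaPFinite) (hCmp : PAdicOrderComparisonR2) :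
    PAdicOrderPadicBSDrankR2 :=
  pAdicOrderPadicBSDrankR2_of_items_of_comparison hMC hSS hSha hCmp

/-- **Composition (A), route-`PAdicOrder` spelling** (byte-identical bodies, `Iff.rfl`).
[cite: MazurTateTeitelbaum1986Invent, §II.10] -/
theorem pAdicOrderPadicBSDrankR2_of_comparison' (hMC : PAdicOrderMainConjectureR7)
    (hSS : Theses.PAdicOrder.PAdicOrderSemisimpleR3) (hSha : SelmerRankShaPFinite)
    (hCmp : Theses.PAdicOrder.PAdicOrderComparisonR2) : Theses.PAdicOrder.PAdicOrderPadicBSDrankR2 :=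
  (Iff.rfl : Theses.PAdicOrder.PAdicOrderPadicBSDrankR2 ↔ PAdicOrderPadicBSDrankR2).mpr
    (pAdicOrderPadicBSDrankR2_of_comparison hMC
      ((Iff.rfl : Theses.PAdicOrder.PAdicOrderSemisimpleR3 ↔ PAdicOrderSemisimpleR3).mp hSS) hSha
      ((Iff.rfl : Theses.PAdicOrder.PAdicOrderComparisonR2 ↔ PAdicOrderComparisonR2).mp hCmp))


/-! ## Glue of v7: LANDED as `Theorems/PAdicOrderV2PadicBSDrankOfItemsParity.lean` (p162419) — stub PT
`stub_padicBSDrank_parity`, `padicBSDrank_exists_order_eq_of_items`, `padicBSDrank_two_le_order_of_items`,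
`padicBSDrank_atTwo_iff_of_items₃`, `pAdicOrderPadicBSDrankR2_of_items₃` (imported above). -/

/-! ## Composition (B): the crux from the route items R7, 0509, 0132 and the stubs K3, NE2w -/

/-- **Composition (B) (line `Sketch`, v7.1; registered stub set K3, NE2w; PT landed).** The crux
`PAdicOrderPadicBSDrankR2` follows from the route items `PAdicOrderMainConjectureR7` (stmt-15426),
`PAdicOrderSemisimpleR3` (stmt-0509), `SelmerRankShaPFinite` (stmt-0132) and the registered stubs K3
and NE2w alone, through the glue `pAdicOrderPadicBSDrankR2_of_items₃` (odd `p`: items + Mazur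
control; `p = 2`: rank `0` by level-zero transfer, parity transfer from an odd prime, `1 ≤ ord`,
K3 from rank `3` on, NE2w). [cite: GreenbergLNM1716, §1 Conj. 1.12–1.13 and p. 65] -/
theorem pAdicOrderPadicBSDrankR2_of (hMC : PAdicOrderMainConjectureR7)
    (hSS : PAdicOrderSemisimpleR3) (hSha : SelmerRankShaPFinite) : PAdicOrderPadicBSDrankR2 :=
  pAdicOrderPadicBSDrankR2_of_items₃ hMC hSS hSha stub_padicBSDrank_kato3
    stub_padicBSDrank_noExcessPairTwoPos

/-- **Composition (B), route-`PAdicOrder` spelling** (the crux and the semisimplicity item of route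
`PAdicOrder` have bodies byte-identical to their `PAdicOrderV2` twins, `Iff.rfl`; same items and
stubs as `pAdicOrderPadicBSDrankR2_of`). [cite: GreenbergLNM1716, §1 Conj. 1.12–1.13 and p. 65] -/
theorem pAdicOrderPadicBSDrankR2_of' (hMC : PAdicOrderMainConjectureR7)
    (hSS : Theses.PAdicOrder.PAdicOrderSemisimpleR3) (hSha : SelmerRankShaPFinite) :
    Theses.PAdicOrder.PAdicOrderPadicBSDrankR2 :=
  (Iff.rfl : Theses.PAdicOrder.PAdicOrderPadicBSDrankR2 ↔ PAdicOrderPadicBSDrankR2).mpr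
    (pAdicOrderPadicBSDrankR2_of hMC
      ((Iff.rfl : Theses.PAdicOrder.PAdicOrderSemisimpleR3 ↔ PAdicOrderSemisimpleR3).mp hSS) hSha)

end Summit.BirchSwinnertonDyer.BirchSwinnertonDyer.Theorems
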